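import Summits.CriticalPhenomena.PercolationContinuityZ3.Theorems.Transplant.SkelFrmBChoiceReadNums
import Summits.CriticalPhenomena.PercolationContinuityZ3.Theorems.Transplant.SkelPhiNegReachReadCK
import HarnessLib

/-!
# N2 (frames-only node `SamePDropOfSkeletonFrm₁`, OPEN) — (ζ″) ledger, THE (C) READING ROWS OF THE PRISM BOX, x-corridor, at the tuple of record:
# **`hPl_Q`** (`−5r₀ + 1 ≤ rdLo₀ ∧ rdHi₀ ≤ 22r₀ − 1`) and **`hPt_Q`** (`−2r₁ + 1 ≤ rdLo₁ ∧ rdHi₁ ≤ 2r₁ − 1`) for the prism box `[(−Z₀, −Z₁), ((N+1)n_L + Z₀, Z₁)]`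
# of the K-G corridor (`kgZ₀/kgZ₁` at `kgM₁/kgWm₂/kgWp₂/kgM₂`, SkelPhiCorridorKGBoxes) read by `rdLo/rdHi` (SkelPhiNegReachRoomsRead) at the staggered fine
# parameters `(Aof κ, n_L, h_L, v_L, v_β, prFA.c₀, prFA.c₁, prFA.D)` and the cells `fcellsA` (`= fcellsS.r`), i.e. the shapes of p5-g16's `hPl/hPt`
# (SkelPhiCorridorKGRoomsQ :162–169 at `du.1 = 0`) — from p5's K-criteria `readLo0/Hi0/Lo1/Hi1_of_budgetK` (SkelPhiNegReachReadCK) with `kq := Kq`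
# and the COMMENSURABILITY **`hsc_Q : c_i'·A·(40·Kq·Δ) = r_i·D`** at `prFA` (`c_i' = A·s_i`, `D = A²Δ`, `r_i = K·s_i`, `K = 40·Kq`), fed by the numbers of
# SkelFrmBChoiceReadNums (`Z₀ ≤ 144n_L`, `(N+1)n_L + Z₀ ≤ 20Kn_L + 5n_L`, `Z₁ ≤ 18sL`, `U·sL ≤ Δ`).  Floors: `EqNumL`, `gFloorKG ≤ g`, `40·K·R′0 ≤ g`.

The arrival-box rows `hLl/hLt` (window `BSlot.small`, creep `cR`) and the depth row `hRD` are the next file.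
builds on p205010 (kernel theorem, internal audit signed; external expert review pending) — nothing in this file uses p205010; NOTHING is claimed about the open
node `SamePDropOfSkeletonFrm₁`.
Lane `prim-bschramm`, seat `prim-bschramm-stmt` (gen 20); helper file (`--supports stmt-CriticalPhenomena-4575 --as helper`); ledger HOME/prim-bschramm-stmt/FRM-PARAMS.md.
[cite: KozmaNitzan2024, §4 Lemma 12 (pp. 23–25), p. 26 (Q_v, M_v, H_{v,x})] [cite: MartineauTassion2017, §4.1]
-/

open scoped Classical

noncomputable section

namespace Summit.CriticalPhenomena.PercolationContinuityZ3.Theorems.Transplant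

namespace PlanarSkeletonFrm

namespace NegB

open Literature.Probability.Percolation Literature.Probability.LatticeModels SimpleGraph
open SkelConc (Consts)
open Skelφ (shearUnit kgSL kgZ₀ kgZ₁ kgM₁ kgM₂ kgWm₂ kgWp₂ rdLo rdHi KGRows)
open TwoAxis.Para (modulus)
open Neg

section Read

variable (κ : Consts) {V : Type} [DecidableEq V] [Countable V] {G : SimpleGraph V} [G.LocallyFinite] (Φ : PlanarSkeletonFrm G) (t : V) (p : unitInterval)
  (D : Skelφ.StepI.DataNS V) (g f mk : ℕ)

/-- **COMMENSURABILITY at `prFA`**: `c_i'·A·(40·Kq·Δ) = r_i·D` for both axes, plus the positivity inputs of the reading criteria (`1 ≤ n_L`, `0 < A`, `0 < D`,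
`0 < Δ`, `0 < c₀`, `0 < c₁`, `1 ≤ Kq`, `40·Kq ≤ r_i`). [this work] -/
theorem hsc_Q (hN : EqNumL κ Φ t p D g f) :
    (prFA κ Φ t p D g f).c₀ * Aof κ * (40 * ((Neg.Kq κ : ℕ) : ℤ) * modulus (nL κ Φ t p D g f) (hL κ Φ t p D g f) (vL κ Φ t p D g f) (vβL κ Φ t p D g f)) =
        ((fcellsA κ Φ t p D g f).r 0 : ℤ) * (prFA κ Φ t p D g f).D ∧
    (prFA κ Φ t p D g f).c₁ * Aof κ * (40 * ((Neg.Kq κ : ℕ) : ℤ) * modulus (nL κ Φ t p D g f) (hL κ Φ t p D g f) (vL κ Φ t p D g f) (vβL κ Φ t p D g f)) =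
        ((fcellsA κ Φ t p D g f).r 1 : ℤ) * (prFA κ Φ t p D g f).D ∧
    1 ≤ nL κ Φ t p D g f ∧ 0 < Aof κ ∧ 0 < (prFA κ Φ t p D g f).D ∧
    0 < modulus (nL κ Φ t p D g f) (hL κ Φ t p D g f) (vL κ Φ t p D g f) (vβL κ Φ t p D g f) ∧
    0 < (prFA κ Φ t p D g f).c₀ ∧ 0 < (prFA κ Φ t p D g f).c₁ ∧ 1 ≤ Neg.Kq κ ∧ (∀ i, 40 * ((Neg.Kq κ : ℕ) : ℤ) ≤ ((fcellsA κ Φ t p D g f).r i : ℤ)) := by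
  obtain ⟨hA, hA0, hD, hc₀, hc₁, hm, hn, hv⟩ := prFA_ids κ Φ t p D g f hN
  obtain ⟨hn1, -⟩ := one_le_of_eqNumL κ Φ t p D g f hN
  have hK : ((fcellsA κ Φ t p D g f).K : ℤ) = Neg.K κ := by exact_mod_cast (fcellsA_K κ Φ t p D g f).1
  have hKq : (Neg.K κ : ℤ) = 40 * ((Neg.Kq κ : ℕ) : ℤ) := by exact_mod_cast Neg.K_eq κ
  have hr : ∀ i, (((fcellsA κ Φ t p D g f).r i : ℕ) : ℤ) = (fcellsA κ Φ t p D g f).K * (fcellsA κ Φ t p D g f).s i := fun i => PCells2.r_eq _ i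
  have hm' : 0 < modulus (nL κ Φ t p D g f) (hL κ Φ t p D g f) (vL κ Φ t p D g f) (vβL κ Φ t p D g f) := hm
  have hD' : (prFA κ Φ t p D g f).D = Aof κ ^ 2 * modulus (nL κ Φ t p D g f) (hL κ Φ t p D g f) (vL κ Φ t p D g f) (vβL κ Φ t p D g f) := hD
  obtain ⟨hc₀p, hc₁p⟩ := prFA_c_pos κ Φ t p D g f
  refine ⟨?_, ?_, hn1, hA0, by rw [hD']; positivity, hm', hc₀p, hc₁p, Neg.one_le_Kq κ, ?_⟩
  · rw [hc₀, hr 0, hD', hK, hKq]; ring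
  · rw [hc₁, hr 1, hD', hK, hKq]; ring
  · intro i
    rw [hr i, hK, hKq]
    have hs : (1 : ℤ) ≤ (fcellsA κ Φ t p D g f).s i := by exact_mod_cast (fcellsA κ Φ t p D g f).hs i
    have hq0 : (0 : ℤ) ≤ ((Neg.Kq κ : ℕ) : ℤ) := by positivity
    nlinarith

/-- Shorthand: the prism box's corners at the tuple of record. [this work] -/
def prismLoQ : Site 2 :=
  ![-kgZ₀ (nL κ Φ t p D g f) (vL κ Φ t p D g f) (kgR κ Φ t p D mk) 0 (kgq κ Φ t p D g f (qxQ κ Φ t p D g f))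
      (kgNv0 κ Φ t p D g f mk (qxQ κ Φ t p D g f) (WxQ κ Φ t p D g f))
      (kgM₁ (nL κ Φ t p D g f) (ℓL κ Φ t p D g f) (hL κ Φ t p D g f) (kgR κ Φ t p D mk) 0 (kgW κ Φ t p D g f (WxQ κ Φ t p D g f))
        (kgNv0 κ Φ t p D g f mk (qxQ κ Φ t p D g f) (WxQ κ Φ t p D g f)))
      (kgM₂ (nL κ Φ t p D g f) (ℓL κ Φ t p D g f) (hL κ Φ t p D g f) (vL κ Φ t p D g f) (kgR κ Φ t p D mk) 0
        (kgq κ Φ t p D g f (qxQ κ Φ t p D g f)) (kgW κ Φ t p D g f (WxQ κ Φ t p D g f)) (kgNv0 κ Φ t p D g f mk (qxQ κ Φ t p D g f) (WxQ κ Φ t p D g f))),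
    -kgZ₁ (nL κ Φ t p D g f) (ℓL κ Φ t p D g f) (hL κ Φ t p D g f) (kgR κ Φ t p D mk) 0 (kgW κ Φ t p D g f (WxQ κ Φ t p D g f))
      (kgNv0 κ Φ t p D g f mk (qxQ κ Φ t p D g f) (WxQ κ Φ t p D g f))
      (kgM₁ (nL κ Φ t p D g f) (ℓL κ Φ t p D g f) (hL κ Φ t p D g f) (kgR κ Φ t p D mk) 0 (kgW κ Φ t p D g f (WxQ κ Φ t p D g f))
        (kgNv0 κ Φ t p D g f mk (qxQ κ Φ t p D g f) (WxQ κ Φ t p D g f)))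
      (kgWm₂ (nL κ Φ t p D g f) (ℓL κ Φ t p D g f) (hL κ Φ t p D g f) (kgR κ Φ t p D mk) 0 (kgW κ Φ t p D g f (WxQ κ Φ t p D g f))
        (kgNv0 κ Φ t p D g f mk (qxQ κ Φ t p D g f) (WxQ κ Φ t p D g f)))
      (kgWp₂ (nL κ Φ t p D g f) (ℓL κ Φ t p D g f) (hL κ Φ t p D g f) (kgR κ Φ t p D mk) 0 (kgW κ Φ t p D g f (WxQ κ Φ t p D g f))
        (kgNv0 κ Φ t p D g f mk (qxQ κ Φ t p D g f) (WxQ κ Φ t p D g f)))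
      (kgM₂ (nL κ Φ t p D g f) (ℓL κ Φ t p D g f) (hL κ Φ t p D g f) (vL κ Φ t p D g f) (kgR κ Φ t p D mk) 0
        (kgq κ Φ t p D g f (qxQ κ Φ t p D g f)) (kgW κ Φ t p D g f (WxQ κ Φ t p D g f)) (kgNv0 κ Φ t p D g f mk (qxQ κ Φ t p D g f) (WxQ κ Φ t p D g f)))]

/-- see `prismLoQ`: the upper corner `((N+1)n_L + Z₀, Z₁)`. [this work] -/
def prismHiQ : Site 2 :=
  ![(((kgNv0 κ Φ t p D g f mk (qxQ κ Φ t p D g f) (WxQ κ Φ t p D g f) : ℕ) : ℤ) + 1) * (nL κ Φ t p D g f : ℤ) +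
      kgZ₀ (nL κ Φ t p D g f) (vL κ Φ t p D g f) (kgR κ Φ t p D mk) 0 (kgq κ Φ t p D g f (qxQ κ Φ t p D g f))
      (kgNv0 κ Φ t p D g f mk (qxQ κ Φ t p D g f) (WxQ κ Φ t p D g f))
      (kgM₁ (nL κ Φ t p D g f) (ℓL κ Φ t p D g f) (hL κ Φ t p D g f) (kgR κ Φ t p D mk) 0 (kgW κ Φ t p D g f (WxQ κ Φ t p D g f))
        (kgNv0 κ Φ t p D g f mk (qxQ κ Φ t p D g f) (WxQ κ Φ t p D g f)))
      (kgM₂ (nL κ Φ t p D g f) (ℓL κ Φ t p D g f) (hL κ Φ t p D g f) (vL κ Φ t p D g f) (kgR κ Φ t p D mk) 0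
        (kgq κ Φ t p D g f (qxQ κ Φ t p D g f)) (kgW κ Φ t p D g f (WxQ κ Φ t p D g f)) (kgNv0 κ Φ t p D g f mk (qxQ κ Φ t p D g f) (WxQ κ Φ t p D g f))),
    kgZ₁ (nL κ Φ t p D g f) (ℓL κ Φ t p D g f) (hL κ Φ t p D g f) (kgR κ Φ t p D mk) 0 (kgW κ Φ t p D g f (WxQ κ Φ t p D g f))
      (kgNv0 κ Φ t p D g f mk (qxQ κ Φ t p D g f) (WxQ κ Φ t p D g f))
      (kgM₁ (nL κ Φ t p D g f) (ℓL κ Φ t p D g f) (hL κ Φ t p D g f) (kgR κ Φ t p D mk) 0 (kgW κ Φ t p D g f (WxQ κ Φ t p D g f))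
        (kgNv0 κ Φ t p D g f mk (qxQ κ Φ t p D g f) (WxQ κ Φ t p D g f)))
      (kgWm₂ (nL κ Φ t p D g f) (ℓL κ Φ t p D g f) (hL κ Φ t p D g f) (kgR κ Φ t p D mk) 0 (kgW κ Φ t p D g f (WxQ κ Φ t p D g f))
        (kgNv0 κ Φ t p D g f mk (qxQ κ Φ t p D g f) (WxQ κ Φ t p D g f)))
      (kgWp₂ (nL κ Φ t p D g f) (ℓL κ Φ t p D g f) (hL κ Φ t p D g f) (kgR κ Φ t p D mk) 0 (kgW κ Φ t p D g f (WxQ κ Φ t p D g f))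
        (kgNv0 κ Φ t p D g f mk (qxQ κ Φ t p D g f) (WxQ κ Φ t p D g f)))
      (kgM₂ (nL κ Φ t p D g f) (ℓL κ Φ t p D g f) (hL κ Φ t p D g f) (vL κ Φ t p D g f) (kgR κ Φ t p D mk) 0
        (kgq κ Φ t p D g f (qxQ κ Φ t p D g f)) (kgW κ Φ t p D g f (WxQ κ Φ t p D g f)) (kgNv0 κ Φ t p D g f mk (qxQ κ Φ t p D g f) (WxQ κ Φ t p D g f)))]

/-- **THE THREE BUDGETS** of the prism box at the tuple of record: `0 ≤ Z₁`, (axis 0, lower) `Δ·Z₀ + |v|·U·(Z₁+1) + 3Δn ≤ 166·Δ·n`, (axis 0, upper)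
`Δ·((N+1)n + Z₀) + |v|·U·(Z₁+1) + 3Δn ≤ (20K + 27)·Δ·n`, (axis 1) `U·(Z₁+1) + 2Δ ≤ 21·Δ`. [this work] -/
theorem prism_budgets (hN : EqNumL κ Φ t p D g f) (hg : gFloorKG κ Φ t p D mk ≤ g) (hg2 : 40 * Neg.K κ * KS0.R'0 κ Φ t p D mk ≤ g) :
    0 ≤ prismHiQ κ Φ t p D g f mk 1 ∧
    modulus (nL κ Φ t p D g f) (hL κ Φ t p D g f) (vL κ Φ t p D g f) (vβL κ Φ t p D g f) * (-(prismLoQ κ Φ t p D g f mk 0)) +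
        |vL κ Φ t p D g f| * (((shearUnit (nL κ Φ t p D g f) (hL κ Φ t p D g f) : ℕ) : ℤ) * (prismHiQ κ Φ t p D g f mk 1 + 1)) +
        3 * modulus (nL κ Φ t p D g f) (hL κ Φ t p D g f) (vL κ Φ t p D g f) (vβL κ Φ t p D g f) * (nL κ Φ t p D g f : ℤ) ≤
      166 * modulus (nL κ Φ t p D g f) (hL κ Φ t p D g f) (vL κ Φ t p D g f) (vβL κ Φ t p D g f) * (nL κ Φ t p D g f : ℤ) ∧
    modulus (nL κ Φ t p D g f) (hL κ Φ t p D g f) (vL κ Φ t p D g f) (vβL κ Φ t p D g f) * (prismHiQ κ Φ t p D g f mk 0) +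
        |vL κ Φ t p D g f| * (((shearUnit (nL κ Φ t p D g f) (hL κ Φ t p D g f) : ℕ) : ℤ) * (prismHiQ κ Φ t p D g f mk 1 + 1)) +
        3 * modulus (nL κ Φ t p D g f) (hL κ Φ t p D g f) (vL κ Φ t p D g f) (vβL κ Φ t p D g f) * (nL κ Φ t p D g f : ℤ) ≤
      (20 * (Neg.K κ : ℤ) + 27) * modulus (nL κ Φ t p D g f) (hL κ Φ t p D g f) (vL κ Φ t p D g f) (vβL κ Φ t p D g f) * (nL κ Φ t p D g f : ℤ) ∧
    (((shearUnit (nL κ Φ t p D g f) (hL κ Φ t p D g f) : ℕ) : ℤ) * (prismHiQ κ Φ t p D g f mk 1 + 1)) +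
        2 * modulus (nL κ Φ t p D g f) (hL κ Φ t p D g f) (vL κ Φ t p D g f) (vβL κ Φ t p D g f) ≤
      21 * modulus (nL κ Φ t p D g f) (hL κ Φ t p D g f) (vL κ Φ t p D g f) (vβL κ Φ t p D g f) := by
  obtain ⟨hZ₀, hfar⟩ := Z₀Q_le κ Φ t p D g f mk hN hg hg2
  have hZ₁ := Z₁Q_le κ Φ t p D g f mk hN hg hg2
  have hUs := UsL_le_modulus κ Φ t p D g f hN
  obtain ⟨-, -, hbig, -, hK, -⟩ := valsQ_floor κ Φ t p D g f mk hN hg hg2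
  obtain ⟨-, -, -, -, -, hm, -⟩ := hsc_Q κ Φ t p D g f hN
  have hv := hN.v_le
  have hva : (0 : ℤ) ≤ |vL κ Φ t p D g f| := abs_nonneg _
  have hU : (0 : ℤ) ≤ ((shearUnit (nL κ Φ t p D g f) (hL κ Φ t p D g f) : ℕ) : ℤ) := by positivity
  have hn0 : (0 : ℤ) ≤ (nL κ Φ t p D g f : ℤ) := by positivity
  have e0 : prismLoQ κ Φ t p D g f mk 0 = -kgZ₀ (nL κ Φ t p D g f) (vL κ Φ t p D g f) (kgR κ Φ t p D mk) 0 (kgq κ Φ t p D g f (qxQ κ Φ t p D g f))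
      (kgNv0 κ Φ t p D g f mk (qxQ κ Φ t p D g f) (WxQ κ Φ t p D g f))
      (kgM₁ (nL κ Φ t p D g f) (ℓL κ Φ t p D g f) (hL κ Φ t p D g f) (kgR κ Φ t p D mk) 0 (kgW κ Φ t p D g f (WxQ κ Φ t p D g f))
        (kgNv0 κ Φ t p D g f mk (qxQ κ Φ t p D g f) (WxQ κ Φ t p D g f)))
      (kgM₂ (nL κ Φ t p D g f) (ℓL κ Φ t p D g f) (hL κ Φ t p D g f) (vL κ Φ t p D g f) (kgR κ Φ t p D mk) 0
        (kgq κ Φ t p D g f (qxQ κ Φ t p D g f)) (kgW κ Φ t p D g f (WxQ κ Φ t p D g f)) (kgNv0 κ Φ t p D g f mk (qxQ κ Φ t p D g f) (WxQ κ Φ t p D g f))) := rfl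
  have e1h : prismHiQ κ Φ t p D g f mk 0 = (((kgNv0 κ Φ t p D g f mk (qxQ κ Φ t p D g f) (WxQ κ Φ t p D g f) : ℕ) : ℤ) + 1) * (nL κ Φ t p D g f : ℤ) +
      kgZ₀ (nL κ Φ t p D g f) (vL κ Φ t p D g f) (kgR κ Φ t p D mk) 0 (kgq κ Φ t p D g f (qxQ κ Φ t p D g f))
      (kgNv0 κ Φ t p D g f mk (qxQ κ Φ t p D g f) (WxQ κ Φ t p D g f))
      (kgM₁ (nL κ Φ t p D g f) (ℓL κ Φ t p D g f) (hL κ Φ t p D g f) (kgR κ Φ t p D mk) 0 (kgW κ Φ t p D g f (WxQ κ Φ t p D g f))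
        (kgNv0 κ Φ t p D g f mk (qxQ κ Φ t p D g f) (WxQ κ Φ t p D g f)))
      (kgM₂ (nL κ Φ t p D g f) (ℓL κ Φ t p D g f) (hL κ Φ t p D g f) (vL κ Φ t p D g f) (kgR κ Φ t p D mk) 0
        (kgq κ Φ t p D g f (qxQ κ Φ t p D g f)) (kgW κ Φ t p D g f (WxQ κ Φ t p D g f)) (kgNv0 κ Φ t p D g f mk (qxQ κ Φ t p D g f) (WxQ κ Φ t p D g f))) := rfl
  have e1 : prismHiQ κ Φ t p D g f mk 1 = kgZ₁ (nL κ Φ t p D g f) (ℓL κ Φ t p D g f) (hL κ Φ t p D g f) (kgR κ Φ t p D mk) 0 (kgW κ Φ t p D g f (WxQ κ Φ t p D g f))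
      (kgNv0 κ Φ t p D g f mk (qxQ κ Φ t p D g f) (WxQ κ Φ t p D g f))
      (kgM₁ (nL κ Φ t p D g f) (ℓL κ Φ t p D g f) (hL κ Φ t p D g f) (kgR κ Φ t p D mk) 0 (kgW κ Φ t p D g f (WxQ κ Φ t p D g f))
        (kgNv0 κ Φ t p D g f mk (qxQ κ Φ t p D g f) (WxQ κ Φ t p D g f)))
      (kgWm₂ (nL κ Φ t p D g f) (ℓL κ Φ t p D g f) (hL κ Φ t p D g f) (kgR κ Φ t p D mk) 0 (kgW κ Φ t p D g f (WxQ κ Φ t p D g f))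
        (kgNv0 κ Φ t p D g f mk (qxQ κ Φ t p D g f) (WxQ κ Φ t p D g f)))
      (kgWp₂ (nL κ Φ t p D g f) (ℓL κ Φ t p D g f) (hL κ Φ t p D g f) (kgR κ Φ t p D mk) 0 (kgW κ Φ t p D g f (WxQ κ Φ t p D g f))
        (kgNv0 κ Φ t p D g f mk (qxQ κ Φ t p D g f) (WxQ κ Φ t p D g f)))
      (kgM₂ (nL κ Φ t p D g f) (ℓL κ Φ t p D g f) (hL κ Φ t p D g f) (vL κ Φ t p D g f) (kgR κ Φ t p D mk) 0
        (kgq κ Φ t p D g f (qxQ κ Φ t p D g f)) (kgW κ Φ t p D g f (WxQ κ Φ t p D g f)) (kgNv0 κ Φ t p D g f mk (qxQ κ Φ t p D g f) (WxQ κ Φ t p D g f))) := rfl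
  have hZ₁0 : 0 ≤ prismHiQ κ Φ t p D g f mk 1 := by rw [e1]; unfold Skelφ.kgZ₁; positivity
  rw [e0, e1h, neg_neg]
  rw [e1] at hZ₁0 ⊢
  set Δ := modulus (nL κ Φ t p D g f) (hL κ Φ t p D g f) (vL κ Φ t p D g f) (vβL κ Φ t p D g f) with hΔ
  set U := ((shearUnit (nL κ Φ t p D g f) (hL κ Φ t p D g f) : ℕ) : ℤ) with hUdef
  set s := kgSL (nL κ Φ t p D g f) (ℓL κ Φ t p D g f) (hL κ Φ t p D g f) with hsdef
  set n := (nL κ Φ t p D g f : ℤ) with hndef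
  set Z₁ := kgZ₁ (nL κ Φ t p D g f) (ℓL κ Φ t p D g f) (hL κ Φ t p D g f) (kgR κ Φ t p D mk) 0 (kgW κ Φ t p D g f (WxQ κ Φ t p D g f))
      (kgNv0 κ Φ t p D g f mk (qxQ κ Φ t p D g f) (WxQ κ Φ t p D g f))
      (kgM₁ (nL κ Φ t p D g f) (ℓL κ Φ t p D g f) (hL κ Φ t p D g f) (kgR κ Φ t p D mk) 0 (kgW κ Φ t p D g f (WxQ κ Φ t p D g f))
        (kgNv0 κ Φ t p D g f mk (qxQ κ Φ t p D g f) (WxQ κ Φ t p D g f)))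
      (kgWm₂ (nL κ Φ t p D g f) (ℓL κ Φ t p D g f) (hL κ Φ t p D g f) (kgR κ Φ t p D mk) 0 (kgW κ Φ t p D g f (WxQ κ Φ t p D g f))
        (kgNv0 κ Φ t p D g f mk (qxQ κ Φ t p D g f) (WxQ κ Φ t p D g f)))
      (kgWp₂ (nL κ Φ t p D g f) (ℓL κ Φ t p D g f) (hL κ Φ t p D g f) (kgR κ Φ t p D mk) 0 (kgW κ Φ t p D g f (WxQ κ Φ t p D g f))
        (kgNv0 κ Φ t p D g f mk (qxQ κ Φ t p D g f) (WxQ κ Φ t p D g f)))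
      (kgM₂ (nL κ Φ t p D g f) (ℓL κ Φ t p D g f) (hL κ Φ t p D g f) (vL κ Φ t p D g f) (kgR κ Φ t p D mk) 0
        (kgq κ Φ t p D g f (qxQ κ Φ t p D g f)) (kgW κ Φ t p D g f (WxQ κ Φ t p D g f)) (kgNv0 κ Φ t p D g f mk (qxQ κ Φ t p D g f) (WxQ κ Φ t p D g f)))
    with hZ₁def
  -- U (Z₁ + 1) ≤ 19 U s ≤ 19 Δ
  have hUZ : U * (Z₁ + 1) ≤ 19 * Δ := by
    have h1 : U * (Z₁ + 1) ≤ U * (19 * s) := mul_le_mul_of_nonneg_left (by linarith) hU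
    nlinarith
  have hvUZ : |vL κ Φ t p D g f| * (U * (Z₁ + 1)) ≤ n * (19 * Δ) := by
    have hUZ0 : 0 ≤ U * (Z₁ + 1) := by positivity
    calc |vL κ Φ t p D g f| * (U * (Z₁ + 1)) ≤ n * (U * (Z₁ + 1)) := mul_le_mul_of_nonneg_right hv hUZ0
      _ ≤ n * (19 * Δ) := mul_le_mul_of_nonneg_left hUZ hn0
  refine ⟨hZ₁0, ?_, ?_, by linarith⟩
  · have := mul_le_mul_of_nonneg_left hZ₀ hm.le
    nlinarith
  · have := mul_le_mul_of_nonneg_left hfar hm.le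
    nlinarith

/-- **THE PRISM READING ROWS, ALONG (axis 0)**: `−5r₀ + 1 ≤ rdLo₀` and `rdHi₀ ≤ 22r₀ − 1` for the prism box at the tuple of record (p5's `hPl` at
`du.1 = 0`). [this work] -/
theorem hPl_Q (hN : EqNumL κ Φ t p D g f) (hg : gFloorKG κ Φ t p D mk ≤ g) (hg2 : 40 * Neg.K κ * KS0.R'0 κ Φ t p D mk ≤ g) :
    -(5 * (((fcellsA κ Φ t p D g f).r 0 : ℕ) : ℤ)) + 1 ≤
        rdLo (Aof κ) (nL κ Φ t p D g f) (hL κ Φ t p D g f) (vL κ Φ t p D g f) (vβL κ Φ t p D g f) (prFA κ Φ t p D g f).c₀ (prFA κ Φ t p D g f).c₁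
          (prFA κ Φ t p D g f).D (prismLoQ κ Φ t p D g f mk) (prismHiQ κ Φ t p D g f mk) 0 ∧
      rdHi (Aof κ) (nL κ Φ t p D g f) (hL κ Φ t p D g f) (vL κ Φ t p D g f) (vβL κ Φ t p D g f) (prFA κ Φ t p D g f).c₀ (prFA κ Φ t p D g f).c₁
          (prFA κ Φ t p D g f).D (prismLoQ κ Φ t p D g f mk) (prismHiQ κ Φ t p D g f mk) 0 ≤ 22 * (((fcellsA κ Φ t p D g f).r 0 : ℕ) : ℤ) - 1 := by
  obtain ⟨hsc0, -, hn1, hA0, hDp, hm, hc₀, -, hkq, hr40⟩ := hsc_Q κ Φ t p D g f hN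
  obtain ⟨hZ₁0, hb1, hb2, -⟩ := prism_budgets κ Φ t p D g f mk hN hg hg2
  obtain ⟨-, -, -, -, hK, -⟩ := valsQ_floor κ Φ t p D g f mk hN hg hg2
  have hn0 : (0 : ℤ) ≤ (nL κ Φ t p D g f : ℤ) := by positivity
  have hl1 : |prismLoQ κ Φ t p D g f mk 1| ≤ prismHiQ κ Φ t p D g f mk 1 := by
    have : prismLoQ κ Φ t p D g f mk 1 = -prismHiQ κ Φ t p D g f mk 1 := rfl
    rw [this, abs_neg, abs_of_nonneg hZ₁0]
  have hh1 : |prismHiQ κ Φ t p D g f mk 1| ≤ prismHiQ κ Φ t p D g f mk 1 := by rw [abs_of_nonneg hZ₁0]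
  have hΔn : 0 ≤ modulus (nL κ Φ t p D g f) (hL κ Φ t p D g f) (vL κ Φ t p D g f) (vβL κ Φ t p D g f) * (nL κ Φ t p D g f : ℤ) :=
    mul_nonneg hm.le hn0
  have hkq' : (1 : ℤ) ≤ ((Neg.Kq κ : ℕ) : ℤ) := by exact_mod_cast hkq
  have hKq : (Neg.K κ : ℤ) = 40 * ((Neg.Kq κ : ℕ) : ℤ) := by exact_mod_cast Neg.K_eq κ
  constructor
  · refine Skelφ.readLo0_of_budgetK (hn := hn1) (hA := hA0) (hD := hDp) (hm := hm) (hc₀ := hc₀) (hkq := hkq) (hsc0 := hsc0) (hr40 := hr40)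
      (B := -(prismLoQ κ Φ t p D g f mk 0)) (X₁ := prismHiQ κ Φ t p D g f mk 1) (m := 5) (by simp) hl1 hh1 ?_
    have h78 := mul_le_mul_of_nonneg_right (show (166 : ℤ) ≤ 40 * ((Neg.Kq κ : ℕ) : ℤ) * 5 by linarith) hΔn
    nlinarith
  · refine Skelφ.readHi0_of_budgetK (hn := hn1) (hD := hDp) (hm := hm) (hc₀ := hc₀) (hkq := hkq) (hsc0 := hsc0) (hr40 := hr40)
      (B := prismHiQ κ Φ t p D g f mk 0) (X₁ := prismHiQ κ Φ t p D g f mk 1) (m := 22) le_rfl hl1 hh1 ?_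
    have h22 := mul_le_mul_of_nonneg_right (show (20 * (Neg.K κ : ℤ) + 27) ≤ 40 * ((Neg.Kq κ : ℕ) : ℤ) * 22 by rw [hKq] at hK ⊢; linarith) hΔn
    nlinarith

/-- **THE PRISM READING ROWS, ACROSS (axis 1)**: `−2r₁ + 1 ≤ rdLo₁` and `rdHi₁ ≤ 2r₁ − 1` (p5's `hPt` at `du.1 = 0`). [this work] -/
theorem hPt_Q (hN : EqNumL κ Φ t p D g f) (hg : gFloorKG κ Φ t p D mk ≤ g) (hg2 : 40 * Neg.K κ * KS0.R'0 κ Φ t p D mk ≤ g) :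
    -(2 * (((fcellsA κ Φ t p D g f).r 1 : ℕ) : ℤ)) + 1 ≤
        rdLo (Aof κ) (nL κ Φ t p D g f) (hL κ Φ t p D g f) (vL κ Φ t p D g f) (vβL κ Φ t p D g f) (prFA κ Φ t p D g f).c₀ (prFA κ Φ t p D g f).c₁
          (prFA κ Φ t p D g f).D (prismLoQ κ Φ t p D g f mk) (prismHiQ κ Φ t p D g f mk) 1 ∧
      rdHi (Aof κ) (nL κ Φ t p D g f) (hL κ Φ t p D g f) (vL κ Φ t p D g f) (vβL κ Φ t p D g f) (prFA κ Φ t p D g f).c₀ (prFA κ Φ t p D g f).c₁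
          (prFA κ Φ t p D g f).D (prismLoQ κ Φ t p D g f mk) (prismHiQ κ Φ t p D g f mk) 1 ≤ 2 * (((fcellsA κ Φ t p D g f).r 1 : ℕ) : ℤ) - 1 := by
  obtain ⟨-, hsc1, hn1, hA0, hDp, hm, -, -, hkq, hr40⟩ := hsc_Q κ Φ t p D g f hN
  obtain ⟨hZ₁0, -, -, hb3⟩ := prism_budgets κ Φ t p D g f mk hN hg hg2
  obtain ⟨-, -, -, -, hK, -⟩ := valsQ_floor κ Φ t p D g f mk hN hg hg2
  have hKq : (Neg.K κ : ℤ) = 40 * ((Neg.Kq κ : ℕ) : ℤ) := by exact_mod_cast Neg.K_eq κ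
  have hU : (0 : ℤ) ≤ ((shearUnit (nL κ Φ t p D g f) (hL κ Φ t p D g f) : ℕ) : ℤ) := by positivity
  have hlo1 : prismLoQ κ Φ t p D g f mk 1 = -prismHiQ κ Φ t p D g f mk 1 := rfl
  have hkq' : (1 : ℤ) ≤ ((Neg.Kq κ : ℕ) : ℤ) := by exact_mod_cast hkq
  have h17 := mul_le_mul_of_nonneg_right (show (21 : ℤ) ≤ 40 * ((Neg.Kq κ : ℕ) : ℤ) * 2 by linarith) hm.le
  constructor
  · refine Skelφ.readLo1_of_budgetK (hD := hDp) (hm := hm) (hkq := hkq) (hsc1 := hsc1) (hr40 := hr40)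
      (B := prismHiQ κ Φ t p D g f mk 1) (m := 2) (by rw [hlo1]) ?_
    have : ((shearUnit (nL κ Φ t p D g f) (hL κ Φ t p D g f) : ℕ) : ℤ) * prismHiQ κ Φ t p D g f mk 1 ≤
        ((shearUnit (nL κ Φ t p D g f) (hL κ Φ t p D g f) : ℕ) : ℤ) * (prismHiQ κ Φ t p D g f mk 1 + 1) := by nlinarith
    nlinarith
  · refine Skelφ.readHi1_of_budgetK (hD := hDp) (hm := hm) (hkq := hkq) (hsc1 := hsc1) (hr40 := hr40)
      (B := prismHiQ κ Φ t p D g f mk 1) (m := 2) le_rfl ?_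
    nlinarith

end Read

end NegB

end PlanarSkeletonFrm

end Summit.CriticalPhenomena.PercolationContinuityZ3.Theorems.Transplant

end
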